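import Summits.AnomalousDissipation.AnomalousDissipation.Theorems.SolenoidalFractalHomogenisationLagrangianStepBandKillLadderArith
import Mathlib.Analysis.Real.Pi.Bounds
import HarnessLib

/-!
# W3-E (ii) `stub_effectiveFrameEnergyL_bandKill`: the carrier-free bounds behind the ladder parameter choice
# (helper for K1L_D `stmt-AnomalousDissipation-27980`)

Summits-side helper file of real-variable lemmas (everything proved; no definitions, no named facts) in which the carrier enters only through
abstract sequences `a, N : ℕ → ℝ` (`a_i ≥ 0`, `N_i > 0`, `Σ_{i<m} a_i τ ≤ 2θ`): the Lipschitz term (`termA_le_half`), the cube-tail term for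
one rung (`termB_one_le_half`, room `≥ L/28`) and for several rungs (`termB_multi_le_half`, `S ≥ κ_S θL + 8c₁N_i`, `κ_S = 120000·C_b c₁`),
the room below the box radius (`room_le_radius`), the one-rung detection (`kN_large_of_not_fit`), and the leak comparisons
(`leak_one`, `leak_multi`). Infrastructure for route-1's rung leaf F-D1.A0 (a frontier FORMAL rung); NOT a proof of anomalous dissipation.
-/

set_option linter.dupNamespace false

namespace Summit.AnomalousDissipation.AnomalousDissipation.Theorems.SolenoidalFractalHomogenisation.LagrangianStep.LadderArith

open Finset

/-! ## The Lipschitz term -/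

/-- **Term A**: `4πKτ·3·(18·CL·A/Δ) ≤ 1/2` when `K ≤ L`, `Aτ ≤ 2θ` and `Δ ≥ 864π·CL·θL`. -/
theorem termA_le_half {K L τ θ CL A Δ : ℝ} (hK0 : 0 ≤ K) (hK : K ≤ L) (hCL : 0 ≤ CL) (hA0 : 0 ≤ A) (hτ : 0 ≤ τ) (hAτ : A * τ ≤ 2 * θ)
    (hΔ : 0 < Δ) (hΔge : 864 * Real.pi * CL * θ * L ≤ Δ) :
    4 * Real.pi * K * τ * 3 * (2 * 3 ^ 2 * (CL * A) / Δ) ≤ 1 / 2 := by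
  have hL : 0 ≤ L := hK0.trans hK
  have h1 : K * (A * τ) ≤ L * (2 * θ) := mul_le_mul hK hAτ (mul_nonneg hA0 hτ) hL
  have h2 : 4 * Real.pi * K * τ * 3 * (2 * 3 ^ 2 * (CL * A) / Δ) = 216 * Real.pi * CL * (K * (A * τ)) / Δ := by ring
  rw [h2, div_le_iff₀ hΔ]
  have hπ := Real.pi_pos.le
  nlinarith [mul_le_mul_of_nonneg_left h1 (by positivity : (0:ℝ) ≤ 216 * Real.pi * CL)]

/-! ## The cube-tail term -/

/-- Sum swap: `Σ_n (Σ_i w_i E_{n,i}) p_n = Σ_i w_i Σ_n E_{n,i} p_n`. -/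
theorem sum_sum_mul_swap (q m : ℕ) (w p : ℕ → ℝ) (E : ℕ → ℕ → ℝ) :
    ∑ n ∈ range q, (∑ i ∈ range m, w i * E n i) * p n = ∑ i ∈ range m, w i * ∑ n ∈ range q, E n i * p n := by
  simp_rw [sum_mul, mul_sum, mul_assoc]
  exact sum_comm

/-- The common reduction of term B to a weighted level sum: with `w_i = 66·C_b·a_i/N_i` and inner rung sums `In_i ≥ 0` bounded through
`(L/N_i)·In_i ≤ M`, `K ≤ L`, `Σ a_iτ ≤ 2θ`: `4πKτ·3·(3·Σ_i w_i In_i) ≤ 2376π C_b · M · 2θ`. -/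
theorem termB_reduce {m : ℕ} (a N In : ℕ → ℝ) (ha : ∀ i, 0 ≤ a i) (hN : ∀ i, 0 < N i) (hIn : ∀ i, 0 ≤ In i)
    {K L τ θ Cb M : ℝ} (hK : K ≤ L) (hτ : 0 ≤ τ) (hsum : (∑ i ∈ range m, a i) * τ ≤ 2 * θ) (hCb : 0 < Cb) (hM : 0 ≤ M)
    (hLIn : ∀ i ∈ range m, L / N i * In i ≤ M) :
    4 * Real.pi * K * τ * 3 * (3 * ∑ i ∈ range m, 66 * (Cb * (a i / N i)) * In i) ≤ 2376 * Real.pi * Cb * (M * (2 * θ)) := by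
  have h1 : 4 * Real.pi * K * τ * 3 * (3 * ∑ i ∈ range m, 66 * (Cb * (a i / N i)) * In i) =
      2376 * Real.pi * Cb * ∑ i ∈ range m, a i * τ * (K / N i * In i) := by
    rw [mul_sum, mul_sum, mul_sum]
    exact sum_congr rfl fun i _ => by have := (hN i).ne'; field_simp; ring
  rw [h1]
  refine mul_le_mul_of_nonneg_left ?_ (by positivity)
  have hsum' : ∑ i ∈ range m, a i * τ ≤ 2 * θ := by rw [← sum_mul]; exact hsum
  refine weighted_sum_le (fun i => mul_nonneg (ha i) hτ) (fun i hi => ?_) hM hsum'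
  calc K / N i * In i ≤ L / N i * In i := mul_le_mul_of_nonneg_right (div_le_div_of_nonneg_right hK (hN i).le) (hIn i)
    _ ≤ M := hLIn i hi

/-- **Term B, one rung**: with room `(S − 2Δ) − 1 ≥ L/28` and the one-rung strain ceiling `θ·(1596672 π C_b c₁) ≤ 1`. -/
theorem termB_one_le_half {m : ℕ} (a N : ℕ → ℝ) (ha : ∀ i, 0 ≤ a i) (hN : ∀ i, 0 < N i) {K L τ θ c₁ Cb : ℝ} (hK0 : 0 ≤ K) (hK : K ≤ L)
    (hτ : 0 ≤ τ) (hsum : (∑ i ∈ range m, a i) * τ ≤ 2 * θ) (hc₁ : 0 < c₁) (hCb : 0 < Cb)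
    (hθ : θ * (1596672 * Real.pi * Cb * c₁) ≤ 1) {Sr Δ : ℕ} (hS : ∀ n : ℕ, L / 28 ≤ ((((n + 1) * Sr - 2 * Δ : ℕ) : ℝ) - 1)) :
    4 * Real.pi * K * τ * 3 * (3 * ∑ n ∈ range 1, (∑ i ∈ range m, 66 * (Cb * (a i / N i)) *
      Real.exp (-(((((n + 1) * Sr - 2 * Δ : ℕ) : ℝ) - 1) / 2 / (c₁ * N i)))) * 3 ^ (n + 1)) ≤ 1 / 2 := by
  rw [sum_sum_mul_swap]
  set In : ℕ → ℝ := fun i => ∑ n ∈ range 1, Real.exp (-(((((n + 1) * Sr - 2 * Δ : ℕ) : ℝ) - 1) / 2 / (c₁ * N i))) * 3 ^ (n + 1) with hIn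
  have hIn0 : ∀ i, 0 ≤ In i := fun i => sum_nonneg fun n _ => by positivity
  have hLIn : ∀ i ∈ range m, L / N i * In i ≤ 168 * c₁ := by
    intro i _
    simp only [hIn, sum_range_one, zero_add, one_mul, pow_one]
    have hNi := hN i
    have h1 : Real.exp (-((((Sr - 2 * Δ : ℕ) : ℝ) - 1) / 2 / (c₁ * N i))) ≤ Real.exp (-((L / N i) / (56 * c₁))) := by
      refine Real.exp_le_exp.2 (neg_le_neg ?_)
      have h := hS 0
      simp only [zero_add, one_mul] at h
      calc L / N i / (56 * c₁) = L / 28 / (2 * (c₁ * N i)) := by field_simp; ring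
        _ ≤ ((((Sr - 2 * Δ : ℕ) : ℝ) - 1)) / (2 * (c₁ * N i)) := div_le_div_of_nonneg_right h (by positivity)
        _ = (((Sr - 2 * Δ : ℕ) : ℝ) - 1) / 2 / (c₁ * N i) := by rw [div_div]
    have h2 := mul_exp_neg_div_le (u := L / N i) (by positivity : (0:ℝ) < 56 * c₁)
    calc L / N i * (Real.exp (-((((Sr - 2 * Δ : ℕ) : ℝ) - 1) / 2 / (c₁ * N i))) * 3)
        ≤ L / N i * (Real.exp (-((L / N i) / (56 * c₁))) * 3) := by
          have hL0 : 0 ≤ L / N i := div_nonneg (hK0.trans hK) hNi.le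
          exact mul_le_mul_of_nonneg_left (mul_le_mul_of_nonneg_right h1 (by norm_num)) hL0
      _ = 3 * (L / N i * Real.exp (-((L / N i) / (56 * c₁)))) := by ring
      _ ≤ 3 * (56 * c₁) := by linarith
      _ = 168 * c₁ := by ring
  refine (termB_reduce a N In ha hN hIn0 hK hτ hsum hCb (by positivity) hLIn).trans ?_
  have hπ := Real.pi_pos
  calc 2376 * Real.pi * Cb * (168 * c₁ * (2 * θ)) = θ * (1596672 * Real.pi * Cb * c₁) / 2 := by ring
    _ ≤ 1 / 2 := by linarith

/-- **Term B, several rungs**: with `S ≥ 4Δ + 2`, `S ≥ 120000·C_b c₁·θL + 8c₁N_i` for every level `i < m`, `θ > 0`. -/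
theorem termB_multi_le_half {m : ℕ} (a N : ℕ → ℝ) (ha : ∀ i, 0 ≤ a i) (hN : ∀ i, 0 < N i) {K L τ θ c₁ Cb : ℝ} (hK0 : 0 ≤ K)
    (hK : K ≤ L) (hτ : 0 ≤ τ) (hsum : (∑ i ∈ range m, a i) * τ ≤ 2 * θ) (hθ : 0 < θ) (hc₁ : 0 < c₁) (hCb : 0 < Cb)
    {Sr Δ : ℕ} (hS4 : 4 * Δ + 2 ≤ Sr) (hSr : ∀ i ∈ range m, 120000 * Cb * c₁ * θ * L + 8 * c₁ * N i ≤ Sr) (q : ℕ) :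
    4 * Real.pi * K * τ * 3 * (3 * ∑ n ∈ range q, (∑ i ∈ range m, 66 * (Cb * (a i / N i)) *
      Real.exp (-(((((n + 1) * Sr - 2 * Δ : ℕ) : ℝ) - 1) / 2 / (c₁ * N i)))) * 3 ^ (n + 1)) ≤ 1 / 2 := by
  rw [sum_sum_mul_swap]
  set κS : ℝ := 120000 * Cb * c₁ with hκS
  have hκS0 : 0 < κS := by positivity
  set In : ℕ → ℝ := fun i => ∑ n ∈ range q, Real.exp (-(((((n + 1) * Sr - 2 * Δ : ℕ) : ℝ) - 1) / 2 / (c₁ * N i))) * 3 ^ (n + 1) with hIn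
  have hIn0 : ∀ i, 0 ≤ In i := fun i => sum_nonneg fun n _ => by positivity
  have hL : 0 ≤ L := hK0.trans hK
  have hLIn : ∀ i ∈ range m, L / N i * In i ≤ 4 * c₁ / (κS * θ) := by
    intro i hi
    have hNi := hN i
    -- the per-level rung sum is at most `e^{−v_i}`, `v_i = κ_S θL/(4c₁N_i)`
    have hv0 : 0 ≤ κS * θ * L / (4 * (c₁ * N i)) := by positivity
    have hSv : 2 + κS * θ * L / (4 * (c₁ * N i)) ≤ (Sr : ℝ) / (4 * (c₁ * N i)) := by
      rw [show 2 + κS * θ * L / (4 * (c₁ * N i)) = (8 * c₁ * N i + κS * θ * L) / (4 * (c₁ * N i)) by field_simp; ring]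
      exact div_le_div_of_nonneg_right (by linarith [hSr i hi]) (by positivity)
    have h1 : In i ≤ Real.exp (-(κS * θ * L / (4 * (c₁ * N i)))) := rung_sum_le_exp_neg (by positivity) hv0 hS4 hSv q
    -- `(L/N_i) e^{−v_i} = (κ_Sθ)⁻¹ · u e^{−u/(4c₁)}`, `u = κ_SθL/N_i`
    have h2 := mul_exp_neg_div_le (u := κS * θ * L / N i) (by positivity : (0:ℝ) < 4 * c₁)
    have h3 : L / N i * Real.exp (-(κS * θ * L / (4 * (c₁ * N i)))) =
        (κS * θ)⁻¹ * (κS * θ * L / N i * Real.exp (-(κS * θ * L / N i / (4 * c₁)))) := by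
      rw [show κS * θ * L / N i / (4 * c₁) = κS * θ * L / (4 * (c₁ * N i)) by rw [div_div]; ring]
      field_simp
    calc L / N i * In i ≤ L / N i * Real.exp (-(κS * θ * L / (4 * (c₁ * N i)))) := mul_le_mul_of_nonneg_left h1 (by positivity)
      _ = (κS * θ)⁻¹ * (κS * θ * L / N i * Real.exp (-(κS * θ * L / N i / (4 * c₁)))) := h3
      _ ≤ (κS * θ)⁻¹ * (4 * c₁) := mul_le_mul_of_nonneg_left h2 (by positivity)
      _ = 4 * c₁ / (κS * θ) := by rw [inv_mul_eq_div]
  refine (termB_reduce a N In ha hN hIn0 hK hτ hsum hCb (by positivity) hLIn).trans ?_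
  have hπ := Real.pi_lt_d2
  have hθ' := hθ.ne'
  calc 2376 * Real.pi * Cb * (4 * c₁ / (κS * θ) * (2 * θ)) = Real.pi * (19008 / 120000) := by rw [hκS]; field_simp; ring
    _ ≤ 1 / 2 := by nlinarith [Real.pi_pos]

/-! ## Room, one-rung detection, and the leak -/

/-- **Room below the box radius**: `L/28 + 4Δ + 2 + (L' + 2Δ) ≤ R` for `R ≥ 4L/7 − 1`, `2L' ≤ L`, `Δ ≤ C_Δ θL + 1`,
`θ(336 C_Δ + 1) ≤ 1`, `L ≥ 560`. -/
theorem room_le_radius {L L' R Δ θ CΔ : ℝ} (hR : 4 * L / 7 - 1 ≤ R) (hL' : 2 * L' ≤ L) (hΔ : Δ ≤ CΔ * θ * L + 1)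
    (hθ0 : 0 ≤ θ) (hθ : θ * (336 * CΔ + 1) ≤ 1) (hL : 560 ≤ L) :
    L / 28 + 4 * Δ + 2 + (L' + 2 * Δ) ≤ R := by
  -- `6 C_Δ θ L ≤ L/56`
  have h1 : 6 * CΔ * θ * L ≤ L / 56 := by
    have hL0 : 0 ≤ L := by linarith
    have : 6 * CΔ * θ ≤ 1 / 56 := by nlinarith
    nlinarith
  nlinarith

/-- **One-rung detection**: if the many-rung size `S_M ≤ 4Δ + 4 + κ_SθL + κ_N N_m` does not fit below a room `≥ L/28 + 4Δ + 2`, and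
`κ_Sθ ≤ 1/112`, `L ≥ 224`, then `κ_N N_m > L/56`. -/
theorem kN_large_of_not_fit {SM room Δ θ L κS κN Nm : ℝ} (hfit : room < SM) (hSM : SM ≤ 4 * Δ + 4 + κS * θ * L + κN * Nm)
    (hroom : L / 28 + 4 * Δ + 2 ≤ room) (hθ0 : 0 ≤ θ) (hθ : θ * (112 * κS + 1) ≤ 1) (hL : 224 ≤ L) :
    L / 56 < κN * Nm := by
  have h1 : κS * θ * L ≤ L / 112 := by
    have hL0 : 0 ≤ L := by linarith
    have : κS * θ ≤ 1 / 112 := by nlinarith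
    nlinarith
  nlinarith

/-- **Leak, one rung**: `2·3^{−1} ≤ e^{−c₃/θ} + e^{−(L−L')/(C₂N_m)}` when `κ_N N_m > L/56`, `C₂ ≥ 1200(κ_N+1)`, `N_m ≥ 1`, `L' ≥ 0`. -/
theorem leak_one {L L' θ c₃ C₂ κN Nm : ℝ} (hkN : L / 56 < κN * Nm) (hκN : 0 < κN) (hC₂ : 1200 * (κN + 1) ≤ C₂) (hNm : 1 ≤ Nm)
    (hL' : 0 ≤ L') (hL : 0 ≤ L) :
    2 * (3 : ℝ)⁻¹ ^ 1 ≤ Real.exp (-(c₃ / θ)) + Real.exp (-((L - L') / (C₂ * Nm))) := by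
  have hC₂0 : 0 < C₂ := by nlinarith
  have ht : (L - L') / (C₂ * Nm) ≤ 1 / 3 := by
    rw [div_le_iff₀ (by positivity)]
    nlinarith [mul_le_mul_of_nonneg_right hC₂ (by linarith : (0:ℝ) ≤ Nm)]
  have h1 := two_thirds_le_exp_neg ht
  have h2 := Real.exp_pos (-(c₃ / θ))
  rw [pow_one]; linarith

/-- **Leak, several rungs**: with `q = ⌊room/S⌋ ≥ 1` rungs (`room < (q+1)S`), `room ≥ L/28 + 6`, `S ≤ c_J θL + κ_N N_m + 8`, the choices
`C₂ ≥ max(10⁵, 1200(κ_N+1))`, `c₃ ≤ 1/(168(c_J+1))`, `θ ≤ 1/(504(c_J+1))`, and `L ≥ 2000`: `2·3^{−q} ≤ e^{−c₃/θ} + e^{−(L−L')/(C₂N_m)}`. -/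
theorem leak_multi {L L' θ c₃ C₂ κN Nm cJ room S : ℝ} {q : ℕ} (hq : 1 ≤ q) (hdiv : room < (q : ℝ) * S + S) (hS0 : 0 < S)
    (hroom : L / 28 + 6 ≤ room) (hS : S ≤ cJ * θ * L + κN * Nm + 8) (hcJ : 0 < cJ) (hκN : 0 < κN) (hNm : 1 ≤ Nm) (hθ : 0 < θ)
    (hC₂ : 100000 ≤ C₂) (hC₂' : 1200 * (κN + 1) ≤ C₂) (hc₃ : c₃ ≤ 1 / (168 * (cJ + 1)))
    (hθJ : θ * (504 * (cJ + 1)) ≤ 1) (hL : 2000 ≤ L) (hL'0 : 0 ≤ L') :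
    2 * (3 : ℝ)⁻¹ ^ q ≤ Real.exp (-(c₃ / θ)) + Real.exp (-((L - L') / (C₂ * Nm))) := by
  have hC₂0 : 0 < C₂ := by linarith
  have he1 := Real.exp_pos (-(c₃ / θ))
  have he2 := Real.exp_pos (-((L - L') / (C₂ * Nm)))
  have hL0 : 0 < L := by linarith
  -- `q + 1 > room / S`
  have hq1 : room / S < (q : ℝ) + 1 := by rw [div_lt_iff₀ hS0]; linarith
  -- the second exponent is at most `L/(C₂ N_m)`
  have ht₂ : (L - L') / (C₂ * Nm) ≤ L / (C₂ * Nm) := div_le_div_of_nonneg_right (by linarith) (by positivity)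
  set a₁ : ℝ := cJ * θ * L with ha₁
  set a₂ : ℝ := κN * Nm with ha₂
  have ha₁0 : 0 < a₁ := by positivity
  have ha₂0 : 0 < a₂ := by positivity
  -- three sub-cases according to the dominant part of `S`
  by_cases hA : a₂ ≤ a₁ ∧ 8 ≤ a₁
  · -- `S ≤ 3 a₁`: many rungs, the strain part of the leak wins
    have hS3 : S ≤ 3 * a₁ := by linarith [hA.1, hA.2]
    have hq2 : L / 28 / (3 * a₁) < (q : ℝ) + 1 := by
      refine lt_of_le_of_lt ?_ hq1
      calc L / 28 / (3 * a₁) ≤ L / 28 / S := div_le_div_of_nonneg_left (by positivity) hS0 hS3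
        _ ≤ room / S := div_le_div_of_nonneg_right (by linarith) hS0.le
    -- `1/(84 c_J θ) < q + 1`, hence `c₃/θ + 1 ≤ q`
    have hq3 : 1 / (84 * cJ * θ) < (q : ℝ) + 1 := by
      rw [show 1 / (84 * cJ * θ) = L / 28 / (3 * a₁) by rw [ha₁]; field_simp; ring]; exact hq2
    have hkey : c₃ / θ + 1 ≤ q := by
      have h1 : c₃ ≤ 1 / (84 * cJ) - 3 * θ := by
        have hθ' : θ ≤ 1 / (504 * (cJ + 1)) := by rw [le_div_iff₀ (by positivity)]; exact hθJ
        have hcJ' : 1 / (84 * (cJ + 1)) ≤ 1 / (84 * cJ) := one_div_le_one_div_of_le (by positivity) (by linarith)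
        have : 1 / (84 * (cJ + 1)) - 3 * (1 / (504 * (cJ + 1))) = 1 / (168 * (cJ + 1)) := by field_simp; ring
        linarith
      have h2 : c₃ / θ ≤ 1 / (84 * cJ * θ) - 3 := by
        rw [div_le_iff₀ hθ]
        calc c₃ ≤ 1 / (84 * cJ) - 3 * θ := h1
          _ = (1 / (84 * cJ * θ) - 3) * θ := by field_simp
      linarith
    exact (two_mul_inv_pow_le_exp_neg hkey).trans (le_add_of_nonneg_right he2.le)
  · by_cases hB : a₁ ≤ a₂ ∧ 8 ≤ a₂
    · -- `S ≤ 3 a₂`: compare with the cell-count part of the leak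
      have hS3 : S ≤ 3 * a₂ := by linarith [hB.1, hB.2]
      have hq2 : L / (84 * a₂) < (q : ℝ) + 1 := by
        refine lt_of_le_of_lt ?_ hq1
        calc L / (84 * a₂) = L / 28 / (3 * a₂) := by rw [div_div]; ring_nf
          _ ≤ L / 28 / S := div_le_div_of_nonneg_left (by positivity) hS0 hS3
          _ ≤ room / S := div_le_div_of_nonneg_right (by linarith) hS0.le
      have ht₃ : L / (C₂ * Nm) ≤ 7 / 100 * (L / (84 * a₂)) := by
        rw [ha₂, div_le_iff₀ (by positivity)]
        have : 7 / 100 * (L / (84 * (κN * Nm))) * (C₂ * Nm) = L * C₂ / (1200 * κN) := by field_simp; ring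
        rw [this, le_div_iff₀ (by positivity)]
        nlinarith
      by_cases hlam : L / (84 * a₂) ≤ 4
      · -- few rungs: the leak is at least `2/3`
        have ht : (L - L') / (C₂ * Nm) ≤ 1 / 3 := by linarith
        exact (two_mul_inv_pow_le_two_thirds hq).trans ((two_thirds_le_exp_neg ht).trans (le_add_of_nonneg_left he1.le))
      · push Not at hlam
        have hkey : (L - L') / (C₂ * Nm) + 1 ≤ q := by linarith
        exact (two_mul_inv_pow_le_exp_neg hkey).trans (le_add_of_nonneg_left he1.le)
    · -- the constant part dominates: `S ≤ 24`
      have hS3 : S ≤ 24 := by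
        push Not at hA hB
        rcases le_total a₂ a₁ with h | h
        · have := hA h; linarith
        · have := hB h; linarith
      have hq2 : (L / 28 + 6) / 24 < (q : ℝ) + 1 := by
        refine lt_of_le_of_lt ?_ hq1
        calc (L / 28 + 6) / 24 ≤ (L / 28 + 6) / S := div_le_div_of_nonneg_left (by positivity) hS0 hS3
          _ ≤ room / S := div_le_div_of_nonneg_right hroom hS0.le
      have ht₃ : L / (C₂ * Nm) ≤ L / 100000 := by
        refine div_le_div_of_nonneg_left hL0.le (by norm_num) ?_
        nlinarith
      have hkey : (L - L') / (C₂ * Nm) + 1 ≤ q := by linarith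
      exact (two_mul_inv_pow_le_exp_neg hkey).trans (le_add_of_nonneg_left he1.le)

end Summit.AnomalousDissipation.AnomalousDissipation.Theorems.SolenoidalFractalHomogenisation.LagrangianStep.LadderArith
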